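import Summits.CriticalPhenomena.PercolationContinuityZ3.Theorems.PercNearOneGluingNoHeavyLowerTailRefinedRowR4Switching
import HarnessLib

/-!
# `NoHeavyLowerTail` (stmt-CriticalPhenomena-4575) — THEOREM R4⁺ of the separating-cluster refinement:
# `s_a · (u_a + s_c) ≤ u_b · (b₀ + s_b)` on EVERY finite weighted graph, by the SAME cluster exchange as R4

Support file (prover prim-gen-kcluster gen 44; `--supports stmt-CriticalPhenomena-4575`).  No named facts, no sorries, no definitions
(cells as in `…RefinedRowR3Switching`: `cellSa/Sb/Sc/B0` refine `a|b|c` by which cluster separates the other two terminals in the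
support, `cellUc x y z = xy|z`).

**Theorem R4⁺** (`r4plus_PrW`): if `b, c ∈ cl D a` then `PrW(S_a) · (PrW(bc|a) + PrW(S_c)) ≤ PrW(ac|b) · (PrW(B_0) + PrW(S_b))`,
i.e. `s_a (u_a + s_c) ≤ u_b (b₀ + s_b)` — gen 42's row R4 `u_a s_a ≤ u_b (b₀ + s_b)` (`RefinedRowR4.r4_PrW`) sharpened by the term `s_a s_c`.
It is the exact dual (`t ↔ q`, separating cells `S_x` ↔ pivotal cells `T_x`, `B_0 ↔ T₀`) of the row dR4⁺ `T_a (u_a + T_c) ≤ u_b (T₀ + T_b)`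
(`PivotalBHK.dualRowR4_PrW`, gen 44), and like dR4⁺ (and unlike R4 / dR4) it is an equality on the tight locus (hub networks).
Census (gen 44, `code/gen44/rside.py`): all connected graphs n = 5 (m ≤ 7) and random graphs n = 6, 7 with random weights, 0 violations; the
automatic exchange prover of gen 43 (`exch11.py`) finds the proof below on all graphs n ≤ 5 (pivot `cl_X(c)`, padding `{(S_a,S_b),(S_a,B_0)}` —
the same as for R4).

**Proof.**  The Gladkov–Zimin one-cluster exchange along `L = cl X c` of `RefinedRowR4.pointwise` also maps `S_a × S_c` into
`(B_0 ∪ S_b) × (U_b ∪ S_a)`: the only facts about `Y` used there are `b ∉ cl Y a` and that `cl Y a` does not separate `b|c`, and for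
`Y ∈ S_c` the latter holds because `cl Y c` separates `a|b` and two distinct terminal clusters cannot both separate
(`RefinedRowR3.not_sep_sep`).  Hence `μ⊗μ(S_a × (U_a ∪ S_b ∪ B_0 ∪ S_c)) ≤ μ⊗μ((B_0 ∪ S_b) × (U_b ∪ S_a))`, i.e.
`s_a (u_a + s_b + b₀ + s_c) ≤ (b₀ + s_b)(u_b + s_a)`.  [cite: GladkovZimin2024, Lemma 4.2 and Example 4.4 (one-cluster exchange)]
-/

noncomputable section

namespace Summit.CriticalPhenomena.PercolationContinuityZ3.Theorems

namespace RefinedRowR4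

open Finset Literature.Probability.Percolation Literature.Probability.Percolation.DecisionTree
open Literature.Probability.Percolation.Gladkov ThreePointLB RefinedRowR3
open scoped Classical

variable {V : Type*} [Fintype V] [DecidableEq V]

/-! ### The pointwise lemma, with the hypotheses on `Y` made explicit -/

section Pointwise

variable {D : Finset (Sym2 V)} {a b c : V}

/-- **Pointwise lemma, abstract form**: for `X ∈ S_a` and any `Y ⊆ D` with `b ∉ cl Y a` whose `a`-cluster does not separate `b|c`,
the exchange along `touch (cl X c)` sends `(X, Y)` to `(B_0 ∪ S_b) × (U_b ∪ S_a)` (the proof of `RefinedRowR4.pointwise`, verbatim).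
[this work] -/
theorem pointwise_of {X Y : Finset (Sym2 V)} (hXD : X ⊆ D) (hYD : Y ⊆ D) (hDb : b ∈ cl D a)
    (hX : X ∈ cellSa D a b c) (hYab : b ∉ cl Y a) (hYnsa : ¬ Sep D (cl Y a) b c) :
    splice (touch (cl X c)) X Y ∈ cellB0 D a b c ∪ cellSb D a b c ∧
      splice (touch (cl X c)) Y X ∈ cellUc a c b ∪ cellSa D a b c := by
  have hX' := hX
  obtain ⟨⟨hab, hac, hbc⟩, hsep⟩ := hX
  set K := cl X a with hK
  set L := cl X c with hL
  set P := splice (touch L) X Y with hP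
  set Q := splice (touch L) Y X with hQ
  have hca : a ∉ L := fun h => hac (mem_cl_comm.1 h)
  have hcb : b ∉ L := fun h => hbc (mem_cl_comm.1 h)
  -- (1) P ∈ B_0 ∪ S_b
  have hPc : cl P c = L := cl_splice_touch X Y c
  have hPa : ∀ u, u ∈ cl P a ↔ u ∈ cl (Y \ touch L) a := fun u => mem_cl_splice_touch_iff_of_not_mem hca u
  have hPb : ∀ u, u ∈ cl P b ↔ u ∈ cl (Y \ touch L) b := fun u => mem_cl_splice_touch_iff_of_not_mem hcb u
  have hPaY : cl P a ⊆ cl Y a := fun u hu => cl_mono Finset.sdiff_subset a ((hPa u).1 hu)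
  have hP_ab : b ∉ cl P a := fun h => hYab (hPaY h)
  have hP_ac : c ∉ cl P a := fun h => not_mem_of_mem_cl_sdiff_touch hca ((hPa c).1 h) (mem_cl_self X c)
  have hP_bc : c ∉ cl P b := fun h => not_mem_of_mem_cl_sdiff_touch hcb ((hPb c).1 h) (mem_cl_self X c)
  have hP_nsa : ¬ Sep D (cl P a) b c := fun h => hYnsa (h.mono hPaY)
  have hP_nsc : ¬ Sep D (cl P c) a b := by
    rw [hPc]
    exact fun h => not_sep_sep (x := a) (y := c) (z := b) hXD hac hDb (sep_comm.1 hsep) h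
  have hP1 : P ∈ cellB0 D a b c ∪ cellSb D a b c := by
    by_cases hP_sb : Sep D (cl P b) a c
    · exact Or.inr ⟨⟨hP_ab, hP_ac, hP_bc⟩, hP_sb⟩
    · exact Or.inl ⟨⟨hP_ab, hP_ac, hP_bc⟩, hP_nsa, hP_sb, hP_nsc⟩
  -- (2) Q ∈ U_b ∪ S_a
  have hKQ : K ⊆ cl Q a := cl_subset_cl_splice_touch_of_not_mem hca
  have hQb : cl Q b ⊆ cl (D \ touch K) b := cl_splice_subset_Rc hXD hYD (cellSa_swap hX')
  have hQ_ab : b ∉ cl Q a := fun h =>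
    not_mem_of_mem_cl_sdiff_touch hab (hQb (mem_cl_comm.1 h)) (mem_cl_self X a)
  have hQ_bc : c ∉ cl Q b := fun h => hsep (hQb h)
  have hP2 : Q ∈ cellUc a c b ∪ cellSa D a b c := by
    by_cases hQ_ac : c ∈ cl Q a
    · exact Or.inl ⟨hQ_ac, hQ_ab⟩
    · exact Or.inr ⟨⟨hQ_ab, hQ_ac, hQ_bc⟩, hsep.mono hKQ⟩
  exact ⟨hP1, hP2⟩

/-- **Pointwise lemma for R4⁺**: for `X ∈ S_a`, `Y ∈ U_a ∪ S_b ∪ B_0 ∪ S_c` the exchange along `touch (cl X c)` sends `(X, Y)` to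
`(B_0 ∪ S_b) × (U_b ∪ S_a)`; the new case `Y ∈ S_c` uses `RefinedRowR3.not_sep_sep` (the clusters of `a` and of `c` cannot both
separate). [this work] -/
theorem pointwise_plus {X Y : Finset (Sym2 V)} (hXD : X ⊆ D) (hYD : Y ⊆ D) (hDb : b ∈ cl D a) (hDc : c ∈ cl D a)
    (hX : X ∈ cellSa D a b c) (hY : Y ∈ (cellUc b c a ∪ (cellSb D a b c ∪ cellB0 D a b c)) ∪ cellSc D a b c) :
    splice (touch (cl X c)) X Y ∈ cellB0 D a b c ∪ cellSb D a b c ∧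
      splice (touch (cl X c)) Y X ∈ cellUc a c b ∪ cellSa D a b c := by
  rcases hY with hY | hY
  · exact pointwise hXD hYD hDb hDc hX hY
  · -- `Y ∈ S_c`: apart, and `cl Y a` does not separate `b|c` since `cl Y c` separates `a|b`
    obtain ⟨⟨hYab, hYac, -⟩, hYsc⟩ := hY
    refine pointwise_of hXD hYD hDb hX hYab fun h => ?_
    exact not_sep_sep (x := a) (y := c) (z := b) hYD hYac hDb (sep_comm.1 h) hYsc

end Pointwise

/-! ### THEOREM R4⁺ -/

section Measure

variable (D : Finset (Sym2 V)) {p : Sym2 V → ℝ} (hp0 : ∀ e, 0 ≤ p e) (hp1 : ∀ e, p e ≤ 1) (a b c : V)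
include hp0 hp1

/-- **THEOREM R4⁺** (`s_a · (u_a + s_c) ≤ u_b · (b₀ + s_b)` on every finite weighted graph whose support joins the terminals):
`PrW(S_a) · (PrW(bc|a) + PrW(S_c)) ≤ PrW(ac|b) · (PrW(B_0) + PrW(S_b))`.  One Gladkov–Zimin cluster exchange along `cl X c`
(`Pr2W_preimage_swapPair`) and `pointwise_plus`. [this work] -/
theorem r4plus_PrW (hDb : b ∈ cl D a) (hDc : c ∈ cl D a) :
    PrW D p (cellSa D a b c) * (PrW D p (cellUc b c a) + PrW D p (cellSc D a b c)) ≤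
      PrW D p (cellUc a c b) * (PrW D p (cellB0 D a b c) + PrW D p (cellSb D a b c)) := by
  set Fm : Finset (Sym2 V) → Finset (Sym2 V) := fun X => touch (cl X c) with hFm
  have hF : SelfDetermined Fm := selfDetermined_touch_cl c
  -- (`S_c` is cut down to configurations inside the support, where it is disjoint from `S_b`)
  set S : Set (Finset (Sym2 V) × Finset (Sym2 V)) :=
    cellSa D a b c ×ˢ ((cellUc b c a ∪ (cellSb D a b c ∪ cellB0 D a b c)) ∪ (cellSc D a b c ∩ {Y | Y ⊆ D})) with hS
  set T : Set (Finset (Sym2 V) × Finset (Sym2 V)) :=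
    (cellB0 D a b c ∪ cellSb D a b c) ×ˢ (cellUc a c b ∪ cellSa D a b c) with hT
  -- the exchange maps S into T (on pairs inside the support)
  have hST : Pr2W D p S ≤ Pr2W D p (swapPair Fm ⁻¹' T) := by
    refine Pr2W_mono D hp0 hp1 fun x hx1 hx2 hx => ?_
    obtain ⟨hX, hY⟩ := Set.mem_prod.1 hx
    have key := pointwise_plus hx1 hx2 hDb hDc hX (hY.imp id fun h => h.1)
    show swapPair Fm x ∈ T
    exact Set.mem_prod.2 ⟨key.1, key.2⟩
  rw [Pr2W_preimage_swapPair D p hF T] at hST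
  -- factorise both sides
  have hdisj1 : Disjoint (cellSb D a b c) (cellB0 D a b c) :=
    Set.disjoint_left.2 fun X h1 h2 => h2.2.2.1 h1.2
  have hdisj2 : Disjoint (cellUc b c a) (cellSb D a b c ∪ cellB0 D a b c) :=
    Set.disjoint_left.2 fun X h1 h2 => by
      rcases h2 with h2 | h2
      · exact h2.1.2.2 h1.1
      · exact h2.1.2.2 h1.1
  have hdisj5 : Disjoint (cellUc b c a ∪ (cellSb D a b c ∪ cellB0 D a b c)) (cellSc D a b c ∩ {Y | Y ⊆ D}) :=
    Set.disjoint_left.2 fun X h1 h2 => by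
      rcases h1 with h1 | h1 | h1
      · exact h2.1.1.2.2 h1.1
      · -- `S_b` and `S_c` are disjoint inside the support: the clusters of `b` and of `c` cannot both separate
        exact not_sep_sep (x := b) (y := c) (z := a) h2.2 h1.1.2.2 (mem_cl_comm.1 hDb)
          (sep_comm.1 h1.2) (sep_comm.1 h2.1.2)
      · exact h1.2.2.2 h2.1.2
  have hSc : PrW D p (cellSc D a b c ∩ {Y | Y ⊆ D}) = PrW D p (cellSc D a b c) :=
    PrW_congr_set D p fun L hL => ⟨fun h => h.1, fun h => ⟨h, hL⟩⟩
  have hdisj3 : Disjoint (cellB0 D a b c) (cellSb D a b c) :=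
    Set.disjoint_left.2 fun X h1 h2 => h1.2.2.1 h2.2
  have hdisj4 : Disjoint (cellUc a c b) (cellSa D a b c) :=
    Set.disjoint_left.2 fun X h1 h2 => h2.1.2.1 h1.1
  rw [hS, Pr2W_prod, PrW_union D p hdisj5, PrW_union D p hdisj2, PrW_union D p hdisj1, hSc] at hST
  rw [hT, Pr2W_prod, PrW_union D p hdisj3, PrW_union D p hdisj4] at hST
  have hsa := PrW_nonneg D hp0 hp1 (cellSa D a b c)
  have hb0 := PrW_nonneg D hp0 hp1 (cellB0 D a b c)
  have hsb := PrW_nonneg D hp0 hp1 (cellSb D a b c)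
  nlinarith [hST, hsa, hb0, hsb]

end Measure

end RefinedRowR4

end Summit.CriticalPhenomena.PercolationContinuityZ3.Theorems

end
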